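import Summits.HubbardSuperconductivity.HubbardLadder.NeelMarshallFloorRows
import Literature.MathematicalPhysics.QuantumLattice.HeisenbergNeelGapBound
import HarnessLib

/-!
# R2 rows (device D13): certified SPIN-GAP CEILINGS for the spin-½ Heisenberg antiferromagnet on the even `L×L` torus from the landed `m_s²` floors — `E₁ − E₀ ≤ J` on every even torus, `≤ 0.9675·J` / `0.9053·J` at `4×4`, `≤ 0.9343·J` at `6×6` — and the link "H₀ ⇒ the gap closes along even tori"

HONEST FRAMING: ladder R1–R4 with certified numbers; no claim on H/H₀. Cell pub-hubbard, seat r2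
(gen 9). Every row is a statement about ONE finite matrix; the last theorem is an implication
between the cell's typed H₀ target and a typed gaplessness statement — neither side is claimed.

## The device (LADDER.md §R2 (D13); OBSERVABLES.md §3 "spin gap"; R2-TABLE §A9)

The R2 observable is the **spectral gap** `Δ(L) = E₁(L) − E₀(L)` of `heisenbergTorus 2 L 1 1`
(spin ½, `J = 1`, all of `H = Σ_{⟨xy⟩} 𝐒_x·𝐒_y` on `(ℤ/Lℤ)²`), typed by the tree's
`Matrix.HasSpectralGap A Δ` ("unique ground state and every other eigenvalue `≥ E₀ + Δ`", Tasaki 2020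
§2.1). The tree's Horsch–von der Linden bound WITH THE SHARP MODEL CONSTANT
(`Literature/…/HeisenbergNeelGapBound.lean`, `gap_mul_re_stagStructure_le`: for the Néel wave
`A = Σ_x ε_x S_x^z`, `[[H,A],A]`'s ground-state expectation is `-(8/3)E₀` exactly and `A` maps the
singlet ground state into its orthogonal complement, so the variational principle in the gap form
gives `Δ · ω₀(𝓢_π) ≤ -4E₀` with `𝓢_π = Σ_{x,y} ε_xε_y 𝐒_x·𝐒_y = L⁴ · m_s²(L)`), divided by a
certified LOWER bound on `m_s²(L)` (the landed KLS two-sum-rule rows `NeelTwoSumRuleRows` and the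
Marshall floor `NeelMarshallFloorRows`) and a certified LOWER bound on `E₀` (Anderson's
`E₀ ≥ -¾L²`, in the tree; or the inherited `4×4` ED enclosure), is a certified CEILING on `Δ(L)`:

* **`spinGap_le_one`** : for EVERY even `L ≥ 4`, `HasSpectralGap (heisenbergTorus 2 L 1 1) Δ → Δ ≤ 1`
  — i.e. `E₁ − E₀ ≤ J`; NO numerical input (the Marshall floor `ω₀(𝓢_π) ≥ -4E₀` meets the
  Horsch–von der Linden ceiling `Δ·ω₀(𝓢_π) ≤ -4E₀` exactly);
* **`spinGap_four_le_of_groundEnergy_le`** : `E₀(4×4) ≤ -11.2284831934 → Δ(4) ≤ 0.9675`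
  (hypothesis = the pub-mbboot [H_4] upper already used by `neelOrderParamSq_four_ge_of_groundEnergy_le`;
  energy lower bound = Anderson, in the tree);
* **`spinGap_four_le_of_groundEnergy_mem`** : the two-sided inherited ED enclosure
  `E₀(4×4) ∈ [-11.2284832475, -11.2284831934]` (pub-mbboot [H_4x4] E2) `→ Δ(4) ≤ 0.9053`;
* **`spinGap_four_le_of_neelOrderParamSq_ge`** (CALIBRATION row, hypothesis = the inherited exact-ED
  value `m_s²(4) ≥ 0.2765`, pub-mbboot §ADV2-A correlator enclosures × 3 by the singlet rule, and the
  ED energy lower endpoint) `→ Δ(4) ≤ 0.6346` — shows the kernel is within 10 % of the truth;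
* **`spinGap_six_le_of_groundEnergy_le`** : `E₀(6×6) ≤ -24.0846218 → Δ(6) ≤ 0.9343` ([H_6]).

Comparator (never an input): exact diagonalisation of the `4×4` torus gives `E₀ = -11.2284832`,
`E₁ = -10.6498849` (the `S = 1`, `k = (π,π)` tower state), `Δ(4) = 0.5786` (float Lanczos in the
`S^z_tot = 0` sector, this seat, reproducing the standard ED tables); the sharp-constant kernel
itself is 91 % saturated there (`Δ·L⁴m_s² = 40.96 ≤ 44.91 = -4E₀`). At `L = 8, 10, 12` the
energy-assisted floors give only `Δ ≤ 1.20 / 1.29 / 1.19`, weaker than the universal `Δ ≤ 1`, and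
are not filed. The ceilings do NOT decay with `L` (the floors decay like `1/L²`): nothing here
bears on the thermodynamic limit.

* **`not_uniformGap_of_neelOrderSpinHalfSquare`** (cell link, Links.md H₀ line): the typed H₀ target
  `NeelOrderSpinHalfSquare` (Néel LRO along even tori for every `J > 0`) implies that NO `Δ > 0` is a
  spectral gap of `heisenbergTorus 2 L 1 1` for all large even `L` — the Horsch–von der Linden /
  Koma–Tasaki "LRO forces low-lying states" dichotomy (`not_hasStaggeredEvenTorusLRO_of_uniform_gap`),
  the finite-volume shadow of the Anderson tower of states. An implication between typed statements;
  neither is claimed.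

References: P. Horsch, W. von der Linden, Z. Phys. B 72 (1988) 181; T. Koma, H. Tasaki, Commun.
Math. Phys. 158 (1993) 191, §7 eq. (7.9), and J. Stat. Phys. 76 (1994) 745, Thm 2.2; H. Tasaki,
J. Stat. Phys. 174 (2019) 735, §2; E. Lieb, D. Mattis, J. Math. Phys. 3 (1962) 749, Thm 2 (Marshall
sign); T. Kennedy, E. H. Lieb, B. S. Shastry, J. Stat. Phys. 53 (1988) 1019; P. W. Anderson, Phys.
Rev. 83 (1951) 1260, 86 (1952) 694; H. Tasaki, *Physics and Mathematics of Quantum Many-Body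
Systems* (2020) §2.1 (`HasSpectralGap`).
-/

noncomputable section

open Matrix Complex Finset Filter Topology Literature.MathematicalPhysics.QuantumLattice
  Literature.Probability.LatticeModels
open scoped ComplexOrder

namespace Summit.HubbardSuperconductivity.HubbardLadder

/-! ### The kernel in cell vocabulary -/

/-- The cell's staggered structure-factor operator is the Literature file's Néel-signed operator
(`neelSign x = (-1)^{Σᵢ xᵢ}` on canonical representatives). [folklore] -/
theorem stagStructureOp_eq_neelSign (L : ℕ) [NeZero L] (n : ℕ) :
    stagStructureOp L n =
      ∑ x : TorusSite 2 L, ∑ y : TorusSite 2 L, ((neelSign x * neelSign y : ℝ) : ℂ) •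
        ∑ α : Fin 3, (siteSpin n x α * siteSpin n y α : Op (TorusSite 2 L) (n + 1)) := rfl

/-- A spectral gap is positive (unfolding `Matrix.HasSpectralGap`). [cite: Tasaki2020, §2.1] -/
theorem spinGap_pos {L : ℕ} [NeZero L] {Δ : ℝ}
    (hΔ : (heisenbergTorus 2 L 1 1).HasSpectralGap Δ) : 0 < Δ :=
  (((heisenbergTorus_isHermitian 2 L 1 1).hasSpectralGap_iff_card_filter Δ).1 hΔ).1

/-- **Horsch–von der Linden with the sharp constant, cell vocabulary**: a spectral gap `Δ` of the
spin-½ Heisenberg antiferromagnet on the even `L×L` torus (`J = 1`) satisfies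
`Δ · Re ω₀(𝓢_π) ≤ -4 E₀`. [cite: HorschVonDerLinden1988] [cite: KomaTasaki1993, §7 eq. (7.9)]
[cite: Tasaki2019Tower, §2] -/
theorem spinGap_mul_re_stagStructureOp_le (L : ℕ) [NeZero L] (hL2 : 2 ∣ L) {Δ : ℝ}
    (hΔ : (heisenbergTorus 2 L 1 1).HasSpectralGap Δ) :
    Δ * ((heisenbergTorus 2 L 1 1).groundStateFunctional (stagStructureOp L 1)).re ≤
      -4 * (heisenbergTorus 2 L 1 1).groundEnergy := by
  rw [stagStructureOp_eq_neelSign]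
  exact gap_mul_re_stagStructure_le L 1 (by norm_num) hL2 hΔ

/-- `Re ω₀(𝓢_π) = L⁴ · m_s²(L)` at `J = 1` (the bridge `neelOrderParamSq_succ_eq_re_groundStateFunctional`).
[folklore] -/
theorem re_groundStateFunctional_stagStructureOp_eq (L : ℕ) [NeZero L] :
    ((heisenbergTorus 2 L 1 1).groundStateFunctional (stagStructureOp L 1)).re =
      (L : ℝ) ^ 4 * neelOrderParamSq L 1 := by
  obtain ⟨k, rfl⟩ : ∃ k, L = k + 1 := ⟨L - 1, by have := NeZero.ne L; omega⟩
  rw [neelOrderParamSq_succ_eq_re_groundStateFunctional]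
  have hL : ((k + 1 : ℕ) : ℝ) ^ 4 ≠ 0 := by positivity
  field_simp

/-- **Spin gap × Néel order parameter**: `Δ · L⁴ · m_s²(L) ≤ -4E₀(L)` (`J = 1`, `L` even).
[cite: HorschVonDerLinden1988] [cite: Tasaki2019Tower, §2] -/
theorem spinGap_mul_neelOrderParamSq_le (L : ℕ) [NeZero L] (hL2 : 2 ∣ L) {Δ : ℝ}
    (hΔ : (heisenbergTorus 2 L 1 1).HasSpectralGap Δ) :
    Δ * ((L : ℝ) ^ 4 * neelOrderParamSq L 1) ≤ -4 * (heisenbergTorus 2 L 1 1).groundEnergy := by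
  rw [← re_groundStateFunctional_stagStructureOp_eq]
  exact spinGap_mul_re_stagStructureOp_le L hL2 hΔ

/-- **Energy-free form** (Anderson's `E₀ ≥ -¾L²` inside): `Δ · L⁴ · m_s²(L) ≤ 3L²` (`J = 1`, `L ≥ 3`
even). [cite: HorschVonDerLinden1988] [cite: Anderson1951] -/
theorem spinGap_mul_neelOrderParamSq_le_three_mul_sq (L : ℕ) [NeZero L] (hL2 : 2 ∣ L) (hL3 : 3 ≤ L)
    {Δ : ℝ} (hΔ : (heisenbergTorus 2 L 1 1).HasSpectralGap Δ) :
    Δ * ((L : ℝ) ^ 4 * neelOrderParamSq L 1) ≤ 3 * (L : ℝ) ^ 2 := by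
  rw [← re_groundStateFunctional_stagStructureOp_eq, stagStructureOp_eq_neelSign]
  have h := gap_mul_re_stagStructure_le_spinHalf L (by norm_num) hL2 hL3 hΔ
  norm_num at h ⊢
  linarith

/-- **The row kernel**: a certified floor `c ≤ m_s²(L)` (`c > 0`) and a certified energy lower
bound `e ≤ E₀(L)` turn a spectral gap into the ceiling `Δ ≤ -4e / (L⁴ c)`. [folklore] -/
theorem spinGap_le_of_le_neelOrderParamSq {L : ℕ} [NeZero L] (hL2 : 2 ∣ L) {Δ : ℝ}
    (hΔ : (heisenbergTorus 2 L 1 1).HasSpectralGap Δ) {c e : ℝ} (hc : 0 < c)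
    (hm : c ≤ neelOrderParamSq L 1) (he : e ≤ (heisenbergTorus 2 L 1 1).groundEnergy) :
    Δ ≤ -4 * e / ((L : ℝ) ^ 4 * c) := by
  have hΔ0 : 0 < Δ := spinGap_pos hΔ
  have hL : (0 : ℝ) < (L : ℝ) := by exact_mod_cast Nat.pos_of_ne_zero (NeZero.ne L)
  have h := spinGap_mul_neelOrderParamSq_le L hL2 hΔ
  rw [le_div_iff₀ (by positivity)]
  calc Δ * ((L : ℝ) ^ 4 * c) ≤ Δ * ((L : ℝ) ^ 4 * neelOrderParamSq L 1) :=
        mul_le_mul_of_nonneg_left (mul_le_mul_of_nonneg_left hm (by positivity)) hΔ0.le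
    _ ≤ -4 * (heisenbergTorus 2 L 1 1).groundEnergy := h
    _ ≤ -4 * e := by linarith

/-- **The energy-free row kernel**: a certified floor `c ≤ m_s²(L)` (`c > 0`, `L ≥ 3` even) gives
`Δ ≤ 3 / (L² c)`. [folklore] -/
theorem spinGap_le_of_le_neelOrderParamSq_energyFree {L : ℕ} [NeZero L] (hL2 : 2 ∣ L) (hL3 : 3 ≤ L)
    {Δ : ℝ} (hΔ : (heisenbergTorus 2 L 1 1).HasSpectralGap Δ) {c : ℝ} (hc : 0 < c)
    (hm : c ≤ neelOrderParamSq L 1) : Δ ≤ 3 / ((L : ℝ) ^ 2 * c) := by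
  have hΔ0 : 0 < Δ := spinGap_pos hΔ
  have hL : (0 : ℝ) < (L : ℝ) := by exact_mod_cast Nat.pos_of_ne_zero (NeZero.ne L)
  have h := spinGap_mul_neelOrderParamSq_le_three_mul_sq L hL2 hL3 hΔ
  rw [le_div_iff₀ (by positivity)]
  have h1 : Δ * ((L : ℝ) ^ 4 * c) ≤ 3 * (L : ℝ) ^ 2 :=
    le_trans (mul_le_mul_of_nonneg_left (mul_le_mul_of_nonneg_left hm (by positivity)) hΔ0.le) h
  have hL2' : (0 : ℝ) < (L : ℝ) ^ 2 := by positivity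
  nlinarith [h1, hL2']

/-! ### The universal row: `E₁ − E₀ ≤ J` on every even torus -/

/-- **Row A9.0 (universal, no numerical input)**: for every even `L ≥ 4`, a spectral gap `Δ` of the
spin-½ Heisenberg antiferromagnet `Σ_{⟨xy⟩} 𝐒_x·𝐒_y` on the `L×L` torus satisfies **`Δ ≤ 1`**, i.e.
`E₁ − E₀ ≤ J`. The Marshall–Lieb–Mattis floor `L⁴m_s²(L) ≥ -4E₀(L)`
(`neelOrderParamSq_ge_of_groundEnergy`) meets the Horsch–von der Linden ceiling
`Δ·L⁴m_s²(L) ≤ -4E₀(L)`; `E₀ < 0` by the dimer bound. Comparator: `Δ(4) = 0.5786` (ED).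
[cite: HorschVonDerLinden1988] [cite: LiebMattis1962, Theorem 2] [cite: Tasaki2019Tower, §2] -/
theorem spinGap_le_one (L : ℕ) [NeZero L] (hL2 : 2 ∣ L) (hL4 : 4 ≤ L) {Δ : ℝ}
    (hΔ : (heisenbergTorus 2 L 1 1).HasSpectralGap Δ) : Δ ≤ 1 := by
  have hL : (0 : ℝ) < (L : ℝ) := by exact_mod_cast Nat.pos_of_ne_zero (NeZero.ne L)
  have hL4' : (0 : ℝ) < (L : ℝ) ^ 4 := by positivity
  have hm := neelOrderParamSq_ge_of_groundEnergy L hL2 (by omega) one_pos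
  have hE : (heisenbergTorus 2 L 1 1).groundEnergy ≤ -(3 * 1 / 8) * (L : ℝ) ^ 2 :=
    heisenbergSquareTorus_groundEnergy_le_dimer zero_le_one L hL2 hL4
  have hE0 : (heisenbergTorus 2 L 1 1).groundEnergy < 0 := by nlinarith [hE, hL]
  have h := spinGap_mul_neelOrderParamSq_le L hL2 hΔ
  have hX : -4 * (heisenbergTorus 2 L 1 1).groundEnergy ≤ (L : ℝ) ^ 4 * neelOrderParamSq L 1 := by
    rw [div_le_iff₀ hL4'] at hm
    linarith
  have hXpos : 0 < (L : ℝ) ^ 4 * neelOrderParamSq L 1 := by linarith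
  have h1 : Δ * ((L : ℝ) ^ 4 * neelOrderParamSq L 1) ≤ 1 * ((L : ℝ) ^ 4 * neelOrderParamSq L 1) := by
    linarith
  exact le_of_mul_le_mul_right h1 hXpos

/-! ### Energy-assisted rows (R2-TABLE §A9; hypotheses = the inherited pub-mbboot energy certificates [H_L] already used by §A8) -/

/-- **Row A9.4**: `E₀(4×4) ≤ -11.2284831934 → Δ(4) ≤ 0.9675` (floor = KLS row
`neelOrderParamSq_four_ge_of_groundEnergy_le : 0.1938 ≤ m_s²(4)`; energy lower bound = Anderson, in
the tree; `3·16 / (256 · 0.1938) = 0.96749…`). Comparator ED `0.5786`.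
[cite: HorschVonDerLinden1988] [cite: KLS1988JSP, eqs. (2)-(4)] [cite: Anderson1951] -/
theorem spinGap_four_le_of_groundEnergy_le {Δ : ℝ} (hΔ : (heisenbergTorus 2 4 1 1).HasSpectralGap Δ)
    (hE : (heisenbergTorus 2 4 1 1).groundEnergy ≤ -11.2284831934) : Δ ≤ 0.9675 := by
  have h := spinGap_le_of_le_neelOrderParamSq_energyFree (L := 4) (by norm_num) (by norm_num) hΔ
    (by norm_num) (neelOrderParamSq_four_ge_of_groundEnergy_le 1 one_pos hE)
  norm_num at h ⊢
  linarith

/-- **Row A9.4′**: the two-sided inherited ED enclosure `E₀(4×4) ∈ [-11.2284832475, -11.2284831934]`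
(pub-mbboot [H_4x4] E2) `→ Δ(4) ≤ 0.9053` (`4·11.2284832475 / (256·0.1938) = 0.90529`).
Comparator ED `0.5786`. [cite: HorschVonDerLinden1988] [cite: KLS1988JSP, eqs. (2)-(4)] -/
theorem spinGap_four_le_of_groundEnergy_mem {Δ : ℝ} (hΔ : (heisenbergTorus 2 4 1 1).HasSpectralGap Δ)
    (hE : (heisenbergTorus 2 4 1 1).groundEnergy ≤ -11.2284831934)
    (hE' : -11.2284832475 ≤ (heisenbergTorus 2 4 1 1).groundEnergy) : Δ ≤ 0.9053 := by
  have h := spinGap_le_of_le_neelOrderParamSq (L := 4) (by norm_num) hΔ (by norm_num)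
    (neelOrderParamSq_four_ge_of_groundEnergy_le 1 one_pos hE) hE'
  norm_num at h ⊢
  linarith

/-- **Row A9.4″ (CALIBRATION row; hypothesis = the inherited exact value of the observable itself)**:
`0.2765 ≤ m_s²(4)` (pub-mbboot §ADV2-A certified ED correlator enclosures `C_zz(0,1) = -0.11696337`,
`C_zz(1,1) = C_zz(0,2) = 0.07125510`, `C_zz(1,2) = -0.06738806`, `C_zz(2,2) = 0.05987513`, times `3`
by the singlet rule: `m_s²(4) = 3·1.47481/16 = 0.27653`) and `-11.2284832475 ≤ E₀(4×4)`
`→ Δ(4) ≤ 0.6346`. Comparator ED `0.5786`: the sharp-constant kernel is within 10 %.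
[cite: HorschVonDerLinden1988] [cite: Tasaki2019Tower, §2] -/
theorem spinGap_four_le_of_neelOrderParamSq_ge {Δ : ℝ}
    (hΔ : (heisenbergTorus 2 4 1 1).HasSpectralGap Δ) (hm : 0.2765 ≤ neelOrderParamSq 4 1)
    (hE' : -11.2284832475 ≤ (heisenbergTorus 2 4 1 1).groundEnergy) : Δ ≤ 0.6346 := by
  have h := spinGap_le_of_le_neelOrderParamSq (L := 4) (by norm_num) hΔ (by norm_num) hm hE'
  norm_num at h ⊢
  linarith

/-- **Row A9.6**: `E₀(6×6) ≤ -24.0846218 → Δ(6) ≤ 0.9343` (floor = KLS row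
`neelOrderParamSq_six_ge_of_groundEnergy_le : 0.0892 ≤ m_s²(6)`, [H_6] integer-MPS upper; Anderson
lower; `108 / (1296·0.0892) = 0.93423…`). Comparator: QMC `m_s²(6) = 0.2098` would give `≤ 0.40`.
[cite: HorschVonDerLinden1988] [cite: KLS1988JSP, eqs. (2)-(4)] [cite: Anderson1951] -/
theorem spinGap_six_le_of_groundEnergy_le {Δ : ℝ} (hΔ : (heisenbergTorus 2 6 1 1).HasSpectralGap Δ)
    (hE : (heisenbergTorus 2 6 1 1).groundEnergy ≤ -24.0846218) : Δ ≤ 0.9343 := by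
  have h := spinGap_le_of_le_neelOrderParamSq_energyFree (L := 6) (by norm_num) (by norm_num) hΔ
    (by norm_num) (neelOrderParamSq_six_ge_of_groundEnergy_le 1 one_pos hE)
  norm_num at h ⊢
  linarith

/-! ### The thermodynamic-limit link: H₀ forces the gap to close along even tori -/

/-- **Cell link (H₀ line)**: the typed H₀ target `NeelOrderSpinHalfSquare` (Néel long-range order of
the spin-½ square-lattice Heisenberg antiferromagnet along even tori, every `J > 0`) implies that
there is NO uniform spectral gap: no `Δ > 0` is a spectral gap of `heisenbergTorus 2 L 1 1` for all
large even `L` (Horsch–von der Linden / Koma–Tasaki: LRO forces low-lying states; the finite-volume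
trace of the Anderson tower). An implication between typed statements; neither side is claimed.
[cite: HorschVonDerLinden1988] [cite: KomaTasaki1994, Theorem 2.2] [cite: Tasaki2019Tower, §2] -/
theorem not_uniformGap_of_neelOrderSpinHalfSquare (h : NeelOrderSpinHalfSquare) :
    ¬ ∃ Δ : ℝ, 0 < Δ ∧ ∀ᶠ k : ℕ in atTop, (heisenbergTorus 2 (2 * k + 2) 1 1).HasSpectralGap Δ := by
  rintro ⟨Δ, hΔ, hgap⟩
  exact not_hasStaggeredEvenTorusLRO_of_uniform_gap (d := 2) (by norm_num) hΔ hgap (h 1 one_pos)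

end Summit.HubbardSuperconductivity.HubbardLadder

end
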